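/-
Copyright (c) 2026. All rights reserved.
Released under Apache 2.0 license as described in the file LICENSE.
Authors: abc-iut cell, wave-6 cone prover seat abc-iut-w6-d025 (gen 4), over this seat's `LogFrobeniusSettingProd.lean` and
abc-iut-w4-d095's `LogFrobeniusLogWallArchOrigin.lean`.
-/
import Literature.AnabelianGeometry.AbsoluteAnabelian.LogFrobeniusSettingProd
import HarnessLib

/-!
# [AbsTopIII] Cor 5.5 (iv), first sentence (`⊞`-half), for PRODUCTS of §5 settings and at the two-sided genuine setting

S. Mochizuki, *Topics in absolute anabelian geometry III*, J. Math. Sci. Univ. Tokyo 22 (2015) [MochizukiAbsTopIII2015];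
manuscript `paper:url-5493eb38cbb7`, Cor 5.5 (iv) p. 131 (proof pp. 132–133: "entirely similar to the proofs of assertion (iv) of
Corollaries 3.6, 4.5" — ONE archimedean place `v₀` and the non-surjective arrow `k× ↪ k` of Def 5.4 (v), Lemma 4.4 mechanism).

PROOF-ONLY.  abc-iut-w4-d095's print-shaped criterion `cor55Incompatibility_of_iota_spaceLink_not_surjective` (any setting: a
set-valued functor on `𝒩⊞_{v₀}` under which every `ι⊞`-edge into the space-link vertex is non-surjective at `x₀`) is applied to
the PRODUCT `L₁.prod L₂` of `LogFrobeniusSettingProd.lean` through the second projection: if the criterion's hypothesis holds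
for the factor `L₂` (resp. `L₁`) under `Φ₂` (resp. `Φ₁`), it holds for the product under `pr₂ ⋙ Φ₂` (resp. `pr₁ ⋙ Φ₁`) — the
first component of `ι⊞` in the product is irrelevant, and the twist identification contributes an isomorphism.  Hence
`LogFrobeniusSetting.prod_cor55Incompatibility_of_snd/_of_fst`, and at the two-sided genuine setting `genuineTwoSided p 𝔄`
(genuine MLF rows × genuine Aut-holomorphic rows): **Cor 5.5 (iv), sentence 1, HOLDS for every index set with an archimedean
place `v₀` and every object `x₀`** (`genuineTwoSided_cor55Incompatibility`), by the archimedean factor's `k× ↪ k` missing `0`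
(`forget_archIota_spaceLink_not_surjective`).  MODEL-LEVEL; refereed pre-IUT material; nothing here bears on [IUTchIII]
Cor. 3.12; no side taken.
-/

set_option autoImplicit false

universe w u

open CategoryTheory

namespace Literature.AnabelianGeometry.AbsoluteAnabelian

namespace LogFrobeniusSetting

variable {Vmod : Type u} {isArc : Vmod → Bool} (L₁ L₂ : LogFrobeniusSetting Vmod isArc)

/-- In the product setting, `ι⊞_{v,ε}` at an object, read through `pr₂` and a set-valued functor `Φ₂` on `𝒩⊞_v` of the second
factor, is `Φ₂(ι⊞₂)` precomposed with the (invertible) image of the twist identification — elementwise.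
[cite: MochizukiAbsTopIII2015, Def 5.4 (vii) p. 128] -/
theorem prod_snd_map_iota_app_apply (v : Vmod) {ν₁ ν₂ : LogVertex (isArc v)} (ε : LogEdge (isArc v) ν₁ ν₂)
    (x : (L₁.prod L₂).X) (Φ₂ : L₂.Nplus v ⥤ Type w) (a : (CategoryTheory.Prod.snd _ _ ⋙ Φ₂).obj (((L₁.prod L₂).lam v ν₁).obj _)) :
    (CategoryTheory.Prod.snd _ _ ⋙ Φ₂).map (((L₁.prod L₂).iota v ε).app x) a =
      Φ₂.map ((L₂.iota v ε).app x.2)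
        (Φ₂.map ((eqToHom (frobeniusTwist_prod_comp L₁ L₂ ν₁.isPostLog v ν₁)).app x).2 a) := by
  change _ = (Φ₂.map ((eqToHom (frobeniusTwist_prod_comp L₁ L₂ ν₁.isPostLog v ν₁)).app x).2 ≫
    Φ₂.map ((L₂.iota v ε).app x.2)) a
  rw [← Φ₂.map_comp]
  rfl

/-- The same through `pr₁` and a set-valued functor on `𝒩⊞_v` of the first factor. [cite: MochizukiAbsTopIII2015, Def 5.4 (vii) p. 128] -/
theorem prod_fst_map_iota_app_apply (v : Vmod) {ν₁ ν₂ : LogVertex (isArc v)} (ε : LogEdge (isArc v) ν₁ ν₂)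
    (x : (L₁.prod L₂).X) (Φ₁ : L₁.Nplus v ⥤ Type w) (a : (CategoryTheory.Prod.fst _ _ ⋙ Φ₁).obj (((L₁.prod L₂).lam v ν₁).obj _)) :
    (CategoryTheory.Prod.fst _ _ ⋙ Φ₁).map (((L₁.prod L₂).iota v ε).app x) a =
      Φ₁.map ((L₁.iota v ε).app x.1)
        (Φ₁.map ((eqToHom (frobeniusTwist_prod_comp L₁ L₂ ν₁.isPostLog v ν₁)).app x).1 a) := by
  change _ = (Φ₁.map ((eqToHom (frobeniusTwist_prod_comp L₁ L₂ ν₁.isPostLog v ν₁)).app x).1 ≫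
    Φ₁.map ((L₁.iota v ε).app x.1)) a
  rw [← Φ₁.map_comp]
  rfl

/-- **Cor 5.5 (iv), sentence 1, for a PRODUCT setting from the criterion on the SECOND factor**: if under `Φ₂` every `ι⊞`-edge
of `L₂` into the space-link vertex at the archimedean place `v₀` is non-surjective at `x₀.2`, then the product has the cycle
obstruction, hence `Cor55Incompatibility`. [cite: MochizukiAbsTopIII2015, Cor 5.5 (iv) p. 131] -/
theorem prod_cor55Incompatibility_of_snd (v₀ : Vmod) (hv₀ : isArc v₀ = true) (x₀ : (L₁.prod L₂).X)
    (Φ₂ : L₂.Nplus v₀ ⥤ Type w)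
    (hΦ : ∀ (ν : LogVertex (isArc v₀)), ν.isPostLog = false →
      ∀ ε : LogEdge (isArc v₀) ν (LogVertex.spaceLink (isArc v₀)),
        ¬ Function.Surjective (Φ₂.map ((L₂.iota v₀ ε).app x₀.2) : _ → _)) :
    (L₁.prod L₂).Cor55Incompatibility :=
  (L₁.prod L₂).cor55Incompatibility_of_iota_spaceLink_not_surjective v₀ hv₀ x₀ (CategoryTheory.Prod.snd _ _ ⋙ Φ₂)
    fun ν hν ε hsurj => hΦ ν hν ε fun z => by
      obtain ⟨a, ha⟩ := hsurj z
      exact ⟨_, (prod_snd_map_iota_app_apply L₁ L₂ v₀ ε x₀ Φ₂ a).symm.trans ha⟩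

/-- The same from the criterion on the FIRST factor. [cite: MochizukiAbsTopIII2015, Cor 5.5 (iv) p. 131] -/
theorem prod_cor55Incompatibility_of_fst (v₀ : Vmod) (hv₀ : isArc v₀ = true) (x₀ : (L₁.prod L₂).X)
    (Φ₁ : L₁.Nplus v₀ ⥤ Type w)
    (hΦ : ∀ (ν : LogVertex (isArc v₀)), ν.isPostLog = false →
      ∀ ε : LogEdge (isArc v₀) ν (LogVertex.spaceLink (isArc v₀)),
        ¬ Function.Surjective (Φ₁.map ((L₁.iota v₀ ε).app x₀.1) : _ → _)) :
    (L₁.prod L₂).Cor55Incompatibility :=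
  (L₁.prod L₂).cor55Incompatibility_of_iota_spaceLink_not_surjective v₀ hv₀ x₀ (CategoryTheory.Prod.fst _ _ ⋙ Φ₁)
    fun ν hν ε hsurj => hΦ ν hν ε fun z => by
      obtain ⟨a, ha⟩ := hsurj z
      exact ⟨_, (prod_fst_map_iota_app_apply L₁ L₂ v₀ ε x₀ Φ₁ a).symm.trans ha⟩

/-! ## At the two-sided genuine setting -/

variable (p : ℕ) [Fact p.Prime] (𝔄 : AutHolFieldFunctor.{0}) (Vmod : Type 1) (isArc : Vmod → Bool)

/-- **[AbsTopIII] Cor 5.5 (iv), first sentence (`⊞`-half), HOLDS at the two-sided genuine setting** `genuineTwoSided p 𝔄`, over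
every index set with an archimedean place `v₀` and every object `x₀ = (A, (𝕏 ↶ M))`: the archimedean factor's `ι⊞` along
`k× ↪ k` misses `0` (abc-iut-w4-d095's `forget_archIota_spaceLink_not_surjective`; print's Lemma 4.4 mechanism at ONE place).
[cite: MochizukiAbsTopIII2015, Cor 5.5 (iv) p. 131] -/
theorem genuineTwoSided_cor55Incompatibility (v₀ : Vmod) (hv₀ : isArc v₀ = true) (x₀ : (genuineTwoSided p 𝔄 Vmod isArc).X) :
    (genuineTwoSided p 𝔄 Vmod isArc).Cor55Incompatibility :=
  prod_cor55Incompatibility_of_snd _ _ v₀ hv₀ x₀ (inducedFunctor _ ⋙ HolTHPair.forget 𝔄)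
    (fun ν _ ε => forget_archIota_spaceLink_not_surjective 𝔄 (isArc v₀) hv₀ ν ε x₀.2)

/-- Existence form: a §5 setting genuine at both place types at which Cor 5.5 (iv) sentence 1 holds whenever there is an
archimedean place and an object. [cite: MochizukiAbsTopIII2015, Cor 5.5 (iv) p. 131] -/
theorem exists_genuineTwoSided_cor55Incompatibility (v₀ : Vmod) (hv₀ : isArc v₀ = true)
    (x₀ : Up (AbsTopIII.TFModel p) × Up (HolTFPair 𝔄)) :
    ∃ L : LogFrobeniusSetting Vmod isArc, L.X = (Up (AbsTopIII.TFModel p) × Up (HolTFPair 𝔄)) ∧ L.Cor55Incompatibility :=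
  ⟨genuineTwoSided p 𝔄 Vmod isArc, rfl, genuineTwoSided_cor55Incompatibility p 𝔄 Vmod isArc v₀ hv₀ x₀⟩

end LogFrobeniusSetting

end Literature.AnabelianGeometry.AbsoluteAnabelian
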